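import Mathlib
import HarnessLib.Audit
import Summits.PneNP.PneNP.Theorems.PstarPathRank
import Summits.PneNP.PneNP.Theorems.PstarQuadRestrict

/-!
# Rank of an AND-sum on a coordinate fibre: freezing gate partners deletes the gated edges (ROUND-24, memo §9 O2; prover-1 g15 T-O2-2)

FRONTIER range-avoidance ladder, rung F-N3, ROUND 24 (cell `pnp-ideate`, planner memo `r24/CORE-BOUND-NOTES.md` §9 O2 / §10; scoping notes
`HOME/pnp-ideate-prover-1/g15/O2-SCOPING.md` §4, §7 T-O2-2 and `HOME/pnp-ideate-prover-2/g18/O1-SCOPING.md` §6; restricted-model proof complexity —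
nothing here bears on `P` versus `NP`).

On a GATE CHAMBER `x₀ + W_Γ` (`W_Γ = coordKer Γ`: the vectors vanishing on the frozen coordinates `Γ`) the forcing dichotomy
(`PstarForcing.forcing_cases`, through `PstarQuadRestrict.quad_restrict`) needs the chord form `Q_D` to keep RANK `≥ 4` AFTER restriction to `W_Γ`.
The generic bound of `PstarQuadRestrict.finrank_rad_restrict_le` loses `2` per frozen coordinate; here the loss is computed exactly for AND-sums:

* `polar_eq_polar_avoid` — on `W_Γ` the polar form of `Q_D` IS the polar form of `Q_{D'}`, `D' = avoid I D Γ` the outputs of `D` whose AND pair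
  avoids `Γ` (a gated edge `a_p a_w`, `w ∈ Γ`, is linear or constant on the chamber);
* `coordSpan_le_rad` — the frozen basis vectors lie in the radical of `B_{D'}`; with `coordKer_sup_coordSpan` / `coordKer_inf_coordSpan`
  (`𝔽₂^n = W_Γ ⊕ ⟨e_Γ⟩`) this gives `rank_restrict_ge`: **`rank_{W_Γ}(B_D|_{W_Γ}) ≥ rank(B_{D'})`** — no loss beyond deleting the gated edges;
* `rank_four_of_not_star_not_shared` — for ANY family `P` on a pure instance with simple overlaps: `P ≠ ∅`, no common AND variable, and NOT every
  AND variable of `P` shared inside `P` ⟹ `rank B_P ≥ 4` (the rank-two structure theorem `PstarPathRank.star_or_shared_of_rank_two` + even rank;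
  no expansion needed);
* `rank_four_on_fibre` — hence `rank ≥ 4` on the chamber as soon as the Γ-avoiding part `D'` of the fundamental set is non-empty, not a star, and has
  an AND variable used once inside `D'`; `forcing_cases_fibre` — `PstarForcing.forcing_cases` on `x₀ + W` with THIS rank hypothesis (the
  restricted-rank form of `PstarQuadRestrict.forcing_cases_restrict`).

So a gate costs rank only through the edges it sits on: the exception of O2-SCOPING §4 (`#D e = 2` with a gate partner on `D e`, the PIN + GATE core)
is exactly `D' = ` one edge (a star).
-/

set_option linter.dupNamespace false -- `Summit.PneNP.PneNP.…`: summit = sub-problem name (D-0017 single-conjunct layout)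

open Finset Module Literature.Computability.Complexity
open Summit.PneNP.PneNP.Theorems.PstarSALevel (SimpleOverlap)
open Summit.PneNP.PneNP.Theorems.PstarGapLinearised (andPair)
open Summit.PneNP.PneNP.Theorems.PstarCubeIdeals (IsAffineFn)
open Summit.PneNP.PneNP.Theorems.PstarProductRank (qform polar polar_apply qform_add)
open Summit.PneNP.PneNP.Theorems.PstarQuadRank (rad mem_rad finrank_rad_add_two_le)
open Summit.PneNP.PneNP.Theorems.PstarRankRigidityTwo (even_rank)
open Summit.PneNP.PneNP.Theorems.PstarForcing (forcing_cases)
open Summit.PneNP.PneNP.Theorems.PstarPathRank (polar_basis polar_self_and polar_symm_and star_or_shared_of_rank_two)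
open Summit.PneNP.PneNP.Theorems.PstarQuadRestrict (quad_restrict)

namespace Summit.PneNP.PneNP.Theorems.PstarPathRankFibre

variable {n m : ℕ}

/-! ## Coordinate subspaces -/

/-- the coordinate subspace of the vectors vanishing on `Γ` (the direction of a gate chamber) -/
def coordKer (Γ : Finset (Fin n)) : Submodule (ZMod 2) (Fin n → ZMod 2) where
  carrier := {x | ∀ w ∈ Γ, x w = 0}
  add_mem' := by
    intro x y hx hy w hw
    show x w + y w = 0
    rw [hx w hw, hy w hw, add_zero]
  zero_mem' := fun _ _ => rfl
  smul_mem' := by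
    intro c x hx w hw
    show c • x w = 0
    rw [hx w hw, smul_zero]

/-- Membership in `coordKer`. -/
theorem mem_coordKer {Γ : Finset (Fin n)} {x : Fin n → ZMod 2} : x ∈ coordKer Γ ↔ ∀ w ∈ Γ, x w = 0 := Iff.rfl

/-- the span of the basis vectors indexed by `Γ` -/
def coordSpan (Γ : Finset (Fin n)) : Submodule (ZMod 2) (Fin n → ZMod 2) :=
  Submodule.span (ZMod 2) (Set.range fun w : Γ => Pi.single (w : Fin n) (1 : ZMod 2))

/-- Vectors of `coordSpan Γ` vanish off `Γ`. -/
theorem eq_zero_of_mem_coordSpan {Γ : Finset (Fin n)} {x : Fin n → ZMod 2} (hx : x ∈ coordSpan Γ) {u : Fin n} (hu : u ∉ Γ) : x u = 0 := by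
  have key : coordSpan Γ ≤ coordKer (univ.filter fun u => u ∉ Γ) := by
    refine Submodule.span_le.2 ?_
    rintro _ ⟨w, rfl⟩ u hu'
    exact Pi.single_eq_of_ne (fun h : u = (w : Fin n) => (mem_filter.1 hu').2 (by rw [h]; exact w.2)) _
  exact key hx u (mem_filter.2 ⟨mem_univ _, hu⟩)

/-- `𝔽₂^n = coordKer Γ + coordSpan Γ`. -/
theorem coordKer_sup_coordSpan (Γ : Finset (Fin n)) : coordKer Γ ⊔ coordSpan Γ = ⊤ := by
  classical
  refine eq_top_iff.2 fun x _ => ?_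
  set xK : Fin n → ZMod 2 := fun i => if i ∈ Γ then 0 else x i with hxK
  set xS : Fin n → ZMod 2 := fun i => if i ∈ Γ then x i else 0 with hxS
  have hsplit : x = xK + xS := by
    funext i
    simp only [hxK, hxS, Pi.add_apply]
    split_ifs <;> simp
  have hK : xK ∈ coordKer Γ := fun w hw => by simp only [hxK, if_pos hw]
  have hS : xS ∈ coordSpan Γ := by
    have hsum : xS = ∑ w ∈ Γ.attach, x w • Pi.single (w : Fin n) (1 : ZMod 2) := by
      funext i
      rw [Finset.sum_apply]
      simp only [hxS, Pi.smul_apply, Pi.single_apply, smul_eq_mul, mul_ite, mul_one, mul_zero]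
      by_cases hi : i ∈ Γ
      · rw [if_pos hi, Finset.sum_eq_single ⟨i, hi⟩]
        · simp
        · intro w _ hw
          rw [if_neg]
          exact fun h => hw (Subtype.ext h.symm)
        · intro h; exact absurd (mem_attach _ _) h
      · rw [if_neg hi]
        refine (sum_eq_zero fun w _ => ?_).symm
        rw [if_neg]
        exact fun h => hi (h ▸ w.2)
    rw [hsum]
    exact Submodule.sum_mem _ fun w _ => Submodule.smul_mem _ _ (Submodule.subset_span ⟨w, rfl⟩)
  rw [hsplit]
  exact Submodule.add_mem_sup hK hS

/-- `coordKer Γ ∩ coordSpan Γ = 0`. -/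
theorem coordKer_inf_coordSpan (Γ : Finset (Fin n)) : coordKer Γ ⊓ coordSpan Γ = ⊥ := by
  refine eq_bot_iff.2 fun x hx => ?_
  obtain ⟨hK, hS⟩ := Submodule.mem_inf.1 hx
  rw [Submodule.mem_bot]
  funext i
  by_cases hi : i ∈ Γ
  · exact hK i hi
  · exact eq_zero_of_mem_coordSpan hS hi

/-! ## Freezing coordinates deletes the gated edges -/

/-- the outputs of `D` whose AND pair avoids `Γ` -/
def avoid (I : LocalMap 4 n m) (D : Finset (Fin m)) (Γ : Finset (Fin n)) : Finset (Fin m) :=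
  D.filter fun j => I.vars j 2 ∉ Γ ∧ I.vars j 3 ∉ Γ

/-- **On the coordinate subspace the polar form of `Q_D` is the polar form of its Γ-avoiding part.** -/
theorem polar_eq_polar_avoid (I : LocalMap 4 n m) (D : Finset (Fin m)) (Γ : Finset (Fin n)) {x y : Fin n → ZMod 2}
    (hx : x ∈ coordKer Γ) (hy : y ∈ coordKer Γ) :
    polar D (fun j => I.vars j 2) (fun j => I.vars j 3) x y = polar (avoid I D Γ) (fun j => I.vars j 2) (fun j => I.vars j 3) x y := by
  classical
  rw [polar_apply, polar_apply]
  unfold avoid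
  rw [sum_filter]
  refine sum_congr rfl fun j _ => ?_
  by_cases h : I.vars j 2 ∉ Γ ∧ I.vars j 3 ∉ Γ
  · rw [if_pos h]
  · rw [if_neg h]
    rw [not_and_or, not_not, not_not] at h
    rcases h with h | h
    · rw [hx _ h, hy _ h, zero_mul, mul_zero, add_zero]
    · rw [hx _ h, hy _ h, zero_mul, mul_zero, add_zero]

/-- The frozen basis vectors lie in the radical of the Γ-avoiding form. -/
theorem single_mem_rad_avoid (I : LocalMap 4 n m) (D : Finset (Fin m)) {Γ : Finset (Fin n)} {w : Fin n} (hw : w ∈ Γ) :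
    Pi.single w (1 : ZMod 2) ∈ rad (polar (avoid I D Γ) (fun j => I.vars j 2) (fun j => I.vars j 3)) := by
  rw [mem_rad]
  intro y
  rw [polar_apply]
  refine sum_eq_zero fun j hj => ?_
  obtain ⟨-, h2, h3⟩ := mem_filter.1 hj
  rw [Pi.single_eq_of_ne (fun h : I.vars j 2 = w => h2 (by rw [h]; exact hw)),
    Pi.single_eq_of_ne (fun h : I.vars j 3 = w => h3 (by rw [h]; exact hw)), zero_mul, zero_mul, add_zero]

/-- `coordSpan Γ ≤ rad B_{D'}`. -/
theorem coordSpan_le_rad (I : LocalMap 4 n m) (D : Finset (Fin m)) (Γ : Finset (Fin n)) :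
    coordSpan Γ ≤ rad (polar (avoid I D Γ) (fun j => I.vars j 2) (fun j => I.vars j 3)) :=
  Submodule.span_le.2 (by rintro _ ⟨w, rfl⟩; exact single_mem_rad_avoid I D w.2)

/-- **No rank is lost beyond the gated edges**: `dim rad(B_D|_{W_Γ}) + n ≤ dim W_Γ + dim rad B_{D'}`, i.e. `rank_{W_Γ}(B_D|_{W_Γ}) ≥ rank B_{D'}`. -/
theorem rank_restrict_ge (I : LocalMap 4 n m) (D : Finset (Fin m)) (Γ : Finset (Fin n)) :
    finrank (ZMod 2) (rad ((polar D (fun j => I.vars j 2) (fun j => I.vars j 3)).restrict (coordKer Γ))) + n ≤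
      finrank (ZMod 2) (coordKer Γ) + finrank (ZMod 2) (rad (polar (avoid I D Γ) (fun j => I.vars j 2) (fun j => I.vars j 3))) := by
  set W := coordKer Γ with hW
  set E := coordSpan Γ with hE
  set B : LinearMap.BilinForm (ZMod 2) (Fin n → ZMod 2) := polar D (fun j => I.vars j 2) (fun j => I.vars j 3) with hB
  set R := rad (polar (avoid I D Γ) (fun j => I.vars j 2) (fun j => I.vars j 3)) with hR
  -- (d) the radical of the restriction, pushed into `V`, lies in `R ⊓ W`
  have hmap : (rad (B.restrict W)).map W.subtype ≤ R ⊓ W := by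
    intro v hv
    obtain ⟨w, hw, rfl⟩ := Submodule.mem_map.1 hv
    have key : ∀ y, polar (avoid I D Γ) (fun j => I.vars j 2) (fun j => I.vars j 3) (w : Fin n → ZMod 2) y = 0 := by
      intro y
      have hy : y ∈ W ⊔ E := by rw [hW, hE, coordKer_sup_coordSpan]; exact Submodule.mem_top
      obtain ⟨y₁, hy₁, y₂, hy₂, rfl⟩ := Submodule.mem_sup.1 hy
      rw [map_add]
      have h1 : polar (avoid I D Γ) (fun j => I.vars j 2) (fun j => I.vars j 3) (w : Fin n → ZMod 2) y₁ = 0 := by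
        rw [← polar_eq_polar_avoid I D Γ w.2 hy₁]
        have h := mem_rad.1 hw ⟨y₁, hy₁⟩
        simp only [LinearMap.BilinForm.restrict_apply, LinearMap.domRestrict_apply] at h
        exact h
      have h2 : polar (avoid I D Γ) (fun j => I.vars j 2) (fun j => I.vars j 3) (w : Fin n → ZMod 2) y₂ = 0 := by
        rw [polar_symm_and]
        exact mem_rad.1 (coordSpan_le_rad I D Γ hy₂) _
      rw [h1, h2, add_zero]
    refine Submodule.mem_inf.2 ⟨?_, w.2⟩
    rw [hR, mem_rad]
    exact key
  have hd : finrank (ZMod 2) (rad (B.restrict W)) ≤ finrank (ZMod 2) (R ⊓ W : Submodule (ZMod 2) (Fin n → ZMod 2)) := by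
    rw [← Submodule.finrank_map_subtype_eq W (rad (B.restrict W))]
    exact Submodule.finrank_mono hmap
  -- (e) `R ⊓ W` and `E` are independent inside `R`
  have he : finrank (ZMod 2) (R ⊓ W : Submodule (ZMod 2) (Fin n → ZMod 2)) + finrank (ZMod 2) E ≤ finrank (ZMod 2) R := by
    have h1 := Submodule.finrank_sup_add_finrank_inf_eq (R ⊓ W) E
    have h2 : (R ⊓ W) ⊓ E = ⊥ := by
      rw [eq_bot_iff]
      intro v hv
      have : v ∈ W ⊓ E := Submodule.mem_inf.2 ⟨(Submodule.mem_inf.1 (Submodule.mem_inf.1 hv).1).2, (Submodule.mem_inf.1 hv).2⟩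
      rwa [hW, hE, coordKer_inf_coordSpan] at this
    rw [h2, finrank_bot, add_zero] at h1
    have h3 : finrank (ZMod 2) ↥((R ⊓ W) ⊔ E) ≤ finrank (ZMod 2) R :=
      Submodule.finrank_mono (sup_le inf_le_left (by rw [hR]; exact coordSpan_le_rad I D Γ))
    omega
  -- (a') `dim W + dim E ≥ n`
  have ha : n ≤ finrank (ZMod 2) W + finrank (ZMod 2) E := by
    have h1 := Submodule.finrank_add_le_finrank_add_finrank W E
    rw [hW, hE, coordKer_sup_coordSpan, finrank_top, Module.finrank_pi, Fintype.card_fin] at h1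
    exact h1
  omega

/-! ## Rank four from the structure of a family -/

/-- **Rank four without expansion.**  On a pure instance with simple overlaps, a non-empty family `P` with no common AND variable in which NOT
every AND variable is shared inside `P` has `rank B_P ≥ 4` (`PstarPathRank.star_or_shared_of_rank_two` + even rank). -/
theorem rank_four_of_not_star_not_shared (I : LocalMap 4 n m) (hI : I.IsPure xorAndPred) (hS : SimpleOverlap I) {P : Finset (Fin m)}
    (hne : P.Nonempty) (hstar : ¬ ∃ d : Fin n, ∀ j ∈ P, d ∈ andPair I j)
    (hshared : ¬ ∀ j₀ ∈ P, ∀ s : Fin 4, 2 ≤ s.val → ∃ j ∈ P, j ≠ j₀ ∧ I.vars j₀ s ∈ andPair I j) :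
    finrank (ZMod 2) (rad (polar P (fun j => I.vars j 2) (fun j => I.vars j 3))) + 4 ≤ finrank (ZMod 2) (Fin n → ZMod 2) := by
  classical
  set B : LinearMap.BilinForm (ZMod 2) (Fin n → ZMod 2) := polar P (fun j => I.vars j 2) (fun j => I.vars j 3) with hBdef
  obtain ⟨j₀, hj₀⟩ := hne
  have hab : B (Pi.single (I.vars j₀ 2) 1) (Pi.single (I.vars j₀ 3) 1) = 1 := by
    rw [hBdef, polar_basis I hI hS, if_pos ⟨j₀, hj₀, Or.inl ⟨rfl, rfl⟩⟩]
  have h2le : finrank (ZMod 2) (rad B) + 2 ≤ finrank (ZMod 2) (Fin n → ZMod 2) :=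
    finrank_rad_add_two_le (polar_self_and I P) (polar_symm_and I P) (by rw [hab]; exact one_ne_zero)
  have hq : ∀ x w : Fin n → ZMod 2, qform P (fun j => I.vars j 2) (fun j => I.vars j 3) (x + w) =
      qform P (fun j => I.vars j 2) (fun j => I.vars j 3) x + qform P (fun j => I.vars j 2) (fun j => I.vars j 3) w +
        qform P (fun j => I.vars j 2) (fun j => I.vars j 3) 0 + B x w := by
    intro x w
    have hz : qform P (fun j => I.vars j 2) (fun j => I.vars j 3) (0 : Fin n → ZMod 2) = 0 := by
      simp only [qform, Pi.zero_apply, mul_zero, sum_const_zero]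
    rw [qform_add, hz, add_zero]
  have heven := even_rank hq
  by_contra h4
  have hrank : finrank (ZMod 2) (Fin n → ZMod 2) ≤ finrank (ZMod 2) (rad B) + 2 := by
    rcases heven with ⟨k, hk⟩
    omega
  rcases star_or_shared_of_rank_two hI hS hab hrank with hst | hsh
  · exact hstar hst
  · exact hshared hsh

/-- **Rank four on a gate chamber.**  If the Γ-avoiding part `D'` of `D` is non-empty, not a star, and has an AND variable used once inside `D'`, then
`Q_D` restricted to `W_Γ = coordKer Γ` has rank `≥ 4` there — the hypothesis of `forcing_cases_fibre`. -/
theorem rank_four_on_fibre (I : LocalMap 4 n m) (hI : I.IsPure xorAndPred) (hS : SimpleOverlap I) (D : Finset (Fin m)) (Γ : Finset (Fin n))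
    (hne : (avoid I D Γ).Nonempty) (hstar : ¬ ∃ d : Fin n, ∀ j ∈ avoid I D Γ, d ∈ andPair I j)
    (hshared : ¬ ∀ j₀ ∈ avoid I D Γ, ∀ s : Fin 4, 2 ≤ s.val → ∃ j ∈ avoid I D Γ, j ≠ j₀ ∧ I.vars j₀ s ∈ andPair I j) :
    finrank (ZMod 2) (rad ((polar D (fun j => I.vars j 2) (fun j => I.vars j 3)).restrict (coordKer Γ))) + 4 ≤
      finrank (ZMod 2) (coordKer Γ) := by
  have h1 := rank_restrict_ge I D Γ
  have h2 := rank_four_of_not_star_not_shared I hI hS hne hstar hshared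
  rw [Module.finrank_pi, Fintype.card_fin] at h2
  omega

/-! ## The forcing dichotomy on a chamber, restricted-rank form -/

/-- **`PstarForcing.forcing_cases` on an affine subspace `x₀ + W`, with the rank hypothesis ON `W`** (`PstarQuadRestrict.forcing_cases_restrict`
asks for rank `≥ 4 + 2·codim W` on the whole space; for coordinate chambers `rank_four_on_fibre` supplies the restricted rank directly). -/
theorem forcing_cases_fibre {M : Type*} [AddCommGroup M] [Module (ZMod 2) M] [Fintype M] {q Q : M → ZMod 2}
    {B B' : LinearMap.BilinForm (ZMod 2) M}
    (hB : ∀ x w, q (x + w) = q x + q w + q 0 + B x w) (hB' : ∀ x w, Q (x + w) = Q x + Q w + Q 0 + B' x w)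
    (W : Submodule (ZMod 2) M) (x₀ : M) (hr : finrank (ZMod 2) (rad (B'.restrict W)) + 4 ≤ finrank (ZMod 2) W) {c : ZMod 2}
    (hZ : ∀ w : W, q (x₀ + w) = 0 → Q (x₀ + w) = c) :
    (∀ w : W, q (x₀ + w) = 1) ∨
    (∃ κ : ZMod 2, ∀ w : W, Q (x₀ + w) = q (x₀ + w) + κ) ∨
    (∃ ν₁ ν₂ : W → ZMod 2, IsAffineFn ν₁ ∧ IsAffineFn ν₂ ∧ ∃ κ : ZMod 2, ∀ w : W, Q (x₀ + w) = q (x₀ + w) + ν₁ w * ν₂ w + κ) ∨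
    (∃ a b : W, (B.restrict W) a b = 1 ∧
      (∀ w : W, q (x₀ + w) = ((B.restrict W) w b + (q (x₀ + b) + q (x₀ + ↑(0 : W)))) *
        ((B.restrict W) w a + (q (x₀ + a) + q (x₀ + ↑(0 : W)))) + 1) ∧
      ∃ m₁ m₂ : W → ZMod 2, IsAffineFn m₁ ∧ IsAffineFn m₂ ∧
        ∀ w : W, Q (x₀ + w) + c = ((B.restrict W) w b + (q (x₀ + b) + q (x₀ + ↑(0 : W))) + 1) * m₁ w +
          ((B.restrict W) w a + (q (x₀ + a) + q (x₀ + ↑(0 : W))) + 1) * m₂ w) := by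
  classical
  haveI : Module.Finite (ZMod 2) M := Module.Finite.of_finite
  have hq₀ := quad_restrict hB W x₀
  have hQ₀ := quad_restrict hB' W x₀
  exact forcing_cases (q := fun w : W => q (x₀ + w)) (Q := fun w : W => Q (x₀ + w)) (fun u w => by simpa using hq₀ u w)
    (fun u w => by simpa using hQ₀ u w) hr hZ

end Summit.PneNP.PneNP.Theorems.PstarPathRankFibre
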